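import Mathlib.Algebra.BigOperators.Ring.Finset
import Mathlib.Analysis.SpecialFunctions.Pow.Real
import Mathlib.Data.Fintype.Powerset
import Mathlib.Tactic.IntervalCases
import HarnessLib

/-!
# Instrument cell `ym-instrument`, crew (b): the exploration + KRAFT INEQUALITY for an ABSTRACT plaquette–link incidence system with at most four links per plaquette and at most six
# plaquettes per link (part 1 of the structure-free re-typing of `ClosedComplexExploration` ∕ `ClosedComplexTailBound`, so that the T2′ tail instantiates on every torus `(ℤ/L)⁴`;
# part 2 = `AbstractPolymerTailBound`)

QUESTIONS.md: Q-B2 (S2-SPEC v0.5.1 §0 reading (β-torus): the (G1) remainder's T2′ tail on the finite torus, RADIUS-DERIVATION v0.6.2 (7.0) consequence (b) «holds there by the local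
encoding» — here typed for ANY finite incidence system); cell `run/shared/lean/pub/ym-instrument/`, HUMAN RULING D-0084 (2), director-ym R138.  HONEST FRAMING (page 1, binding).
WHAT IS CERTIFIED HERE: PURE COMBINATORICS of a finite abstract incidence system `𝓘 = (edges : P → Finset E)` with `#edges p ≤ 4` for every plaquette `p` and `#{p : e ∈ edges p} ≤ 6`
for every link `e` (the two facts the `ℤ⁴` proof used: `card_plaquetteEdges_le`, `card_plaquettesTouching_singleton_le`; true on every torus `(ℤ/L)^4`, `L ≥ 3`): for every link
predicate `Adm` and every admissible root `e`, the number of `n`-element plaquette sets `X ∋ e`-through (`e ∈ links X`), connected through shared admissible links and with every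
admissible link of `X` in `≥ 2` members of `X`, is `≤ (7/10)·((100/19)(119/100)^6)^n ≤ (7/10)·(299/20)^n` (`admClosedCount_le_T2`).  The proof is the landed `ℤ⁴` proof VERBATIM
(exploration `State/und/sel/step`, block weight `bw`, run weight `wt`, Kraft `kraft`/`kraft_root_sum`, invariant `Inv`, potentials `Φ/U/μ`, `wt_lower`, `W_lower`), with the finite
valid family taken inside `Finset.univ` (finite `P`).  NOT a statement about any gauge theory, NOT a radius, NOT summit-bearing.  Grade (T).
-/

noncomputable section

open Finset

namespace Summit.QuantumFields.YangMills.Theorems.Instrument.AbstractPolymerKraft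

/-- A finite **plaquette–link incidence system**: every plaquette has at most four links, every link lies in at most six plaquettes. [folklore] -/
structure IncidenceSystem (P E : Type*) [Fintype P] [DecidableEq E] where
  /-- the links of a plaquette -/
  edges : P → Finset E
  /-- at most four links per plaquette -/
  card_edges_le : ∀ p, (edges p).card ≤ 4
  /-- at most six plaquettes through a link -/
  card_through_le : ∀ e, (Finset.univ.filter fun p => e ∈ edges p).card ≤ 6

variable {P E : Type*} [Fintype P] [DecidableEq P] [DecidableEq E] [Inhabited E] (𝓘 : IncidenceSystem P E)

/-! ## §1 Vocabulary -/

/-- The links of a plaquette set. [folklore] -/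
def links (X : Finset P) : Finset E := X.biUnion 𝓘.edges

/-- The plaquettes of `Y` through the link `l`. [folklore] -/
abbrev atLink (Y : Finset P) (l : E) : Finset P := Y.filter fun p => l ∈ 𝓘.edges p

/-- The plaquettes through the link `l`. [folklore] -/
def through (l : E) : Finset P := Finset.univ.filter fun p => l ∈ 𝓘.edges p

/-- **Connected through admissible links**: any two members are joined inside the set by a chain, consecutive members sharing a link `e` with `Adm e`. [folklore] -/
def IsAdmConnected (Adm : E → Prop) (X : Finset P) : Prop :=
  ∀ p ∈ X, ∀ q ∈ X, Relation.ReflTransGen (fun a b => a ∈ X ∧ b ∈ X ∧ ∃ e, Adm e ∧ e ∈ 𝓘.edges a ∧ e ∈ 𝓘.edges b) p q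

/-- **Closed on admissible links**: every admissible link of `X` lies in at least two members of `X`. [folklore] -/
def AdmClosed (Adm : E → Prop) (X : Finset P) : Prop := ∀ l ∈ links 𝓘 X, Adm l → 2 ≤ (atLink 𝓘 X l).card

/-! ## §2 The exploration process and its Kraft inequality (verbatim from `ClosedComplexExploration`) -/

/-- A state of the exploration: the plaquettes born so far and the links already decided. [folklore] -/
structure State (P E : Type*) where
  /-- plaquettes born so far -/
  Y : Finset P
  /-- links already decided -/
  D : Finset E

variable (Adm : E → Prop) [DecidablePred Adm]

/-- The undecided links of a state: ADMISSIBLE links of the born plaquettes not yet decided. [folklore] -/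
def und (s : State P E) : Finset E := (links 𝓘 s.Y).filter Adm \ s.D

/-- A selection rule: some element of a nonempty link set. [folklore] -/
def sel (U : Finset E) : E := if h : U.Nonempty then h.choose else default

omit [DecidableEq E] in
/-- The selected link belongs to the set. [folklore] -/
theorem sel_mem {U : Finset E} (h : U.Nonempty) : sel U ∈ U := by
  unfold sel; rw [dif_pos h]; exact h.choose_spec

/-- One block: decide the selected undecided link, the plaquettes of `X` through it are born. [folklore] -/
def step (s : State P E) (X : Finset P) : State P E :=
  ⟨s.Y ∪ atLink 𝓘 (X \ s.Y) (sel (und 𝓘 Adm s)), insert (sel (und 𝓘 Adm s)) s.D⟩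

/-- The Kraft parameter `x = 19/100`. [folklore] -/
def xK : ℝ := 19 / 100

/-- The per-present-plaquette factor `y = (1 + x)^{−2} = (100/119)²`. [folklore] -/
def yK : ℝ := (100 / 119) ^ 2

/-- `0 < x`. [folklore] -/
theorem xK_pos : 0 < xK := by unfold xK; norm_num

/-- `0 < y`. [folklore] -/
theorem yK_pos : 0 < yK := by unfold yK; positivity

/-- `y ≤ 1`. [folklore] -/
theorem yK_le_one : yK ≤ 1 := by unfold yK; norm_num

/-- Block weight `[2 ≤ c + m]·x^m·y^c`. [folklore] -/
def bw (c m : ℕ) : ℝ := if 2 ≤ c + m then xK ^ m * yK ^ c else 0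

/-- Block weights are nonnegative. [folklore] -/
theorem bw_nonneg (c m : ℕ) : 0 ≤ bw c m := by
  unfold bw; split_ifs
  · exact mul_nonneg (pow_nonneg xK_pos.le _) (pow_nonneg yK_pos.le _)
  · exact le_rfl

/-- The run weight towards the target `X` from the state `s` with fuel `k`. [folklore] -/
def wt : ℕ → State P E → Finset P → ℝ
  | 0, s, X => if und 𝓘 Adm s = ∅ then (if s.Y = X then 1 else 0) else 0
  | k + 1, s, X => if und 𝓘 Adm s = ∅ then (if s.Y = X then 1 else 0) else
      bw (atLink 𝓘 s.Y (sel (und 𝓘 Adm s))).card (atLink 𝓘 (X \ s.Y) (sel (und 𝓘 Adm s))).card * wt k (step 𝓘 Adm s X) X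

/-- At a terminal state the weight is the indicator of the target. [folklore] -/
theorem wt_terminal {k : ℕ} {s : State P E} {X : Finset P} (h : und 𝓘 Adm s = ∅) : wt 𝓘 Adm k s X = if s.Y = X then 1 else 0 := by
  cases k <;> simp [wt, h]

/-- One block at a non-terminal state. [folklore] -/
theorem wt_succ {k : ℕ} {s : State P E} {X : Finset P} (h : und 𝓘 Adm s ≠ ∅) :
    wt 𝓘 Adm (k + 1) s X = bw (atLink 𝓘 s.Y (sel (und 𝓘 Adm s))).card (atLink 𝓘 (X \ s.Y) (sel (und 𝓘 Adm s))).card * wt 𝓘 Adm k (step 𝓘 Adm s X) X := by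
  simp [wt, h]

omit [Fintype P] [DecidableEq P] in
/-- `Σ_{S ⊆ A} x^{|S|} = (1 + x)^{|A|}`. [folklore] -/
theorem sum_powerset_xK (A : Finset P) : ∑ S ∈ A.powerset, xK ^ S.card = (xK + 1) ^ A.card := by
  have h := Finset.sum_pow_mul_eq_add_pow xK 1 A
  simpa using h

/-- Block weights with `c ≥ 2`. [folklore] -/
theorem bw_of_two_le {c : ℕ} (hc : 2 ≤ c) (m : ℕ) : bw c m = xK ^ m * yK ^ c := by
  unfold bw; rw [if_pos (by omega)]

/-- Block weights with one plaquette present. [folklore] -/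
theorem bw_one (m : ℕ) : bw 1 m = xK ^ m * yK - if m = 0 then yK else 0 := by
  unfold bw
  rcases Nat.eq_zero_or_pos m with rfl | hm
  · simp
  · rw [if_pos (by omega), if_neg (by omega), pow_one, sub_zero]

/-- Root-block weights. [folklore] -/
theorem bw_zero (m : ℕ) : bw 0 m = xK ^ m - (if m = 0 then 1 else 0) - (if m = 1 then xK else 0) := by
  unfold bw
  rcases Nat.lt_or_ge m 2 with hm | hm
  · interval_cases m <;> simp
  · rw [if_pos (by omega), if_neg (by omega), if_neg (by omega), pow_zero, mul_one, sub_zero, sub_zero]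

omit [Fintype P] [DecidableEq P] in
/-- `Σ_{S ⊆ A} bw 0 |S| = (1+x)^{|A|} − 1 − |A|·x`. [folklore] -/
theorem sum_bw_zero (A : Finset P) : ∑ S ∈ A.powerset, bw 0 S.card = (xK + 1) ^ A.card - 1 - A.card * xK := by
  simp_rw [bw_zero, sum_sub_distrib, sum_powerset_xK]
  have h0 : ∑ S ∈ A.powerset, (if S.card = 0 then (1 : ℝ) else 0) = 1 := by
    rw [sum_ite, sum_const_zero, add_zero, sum_const, nsmul_eq_mul, mul_one, ← powersetCard_eq_filter, card_powersetCard,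
      Nat.choose_zero_right, Nat.cast_one]
  have h1 : ∑ S ∈ A.powerset, (if S.card = 1 then xK else 0) = A.card * xK := by
    rw [sum_ite, sum_const_zero, add_zero, sum_const, nsmul_eq_mul, ← powersetCard_eq_filter, card_powersetCard, Nat.choose_one_right]
  rw [h0, h1]

omit [Fintype P] [DecidableEq P] in
/-- `Σ_{S ⊆ A} bw 1 |S| = ((1+x)^{|A|} − 1)·y`. [folklore] -/
theorem sum_bw_one (A : Finset P) : ∑ S ∈ A.powerset, bw 1 S.card = ((xK + 1) ^ A.card - 1) * yK := by
  simp_rw [bw_one, sum_sub_distrib, ← sum_mul, sum_powerset_xK]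
  have h0 : ∑ S ∈ A.powerset, (if S.card = 0 then yK else 0) = yK := by
    rw [sum_ite, sum_const_zero, add_zero, sum_const, nsmul_eq_mul, ← powersetCard_eq_filter, card_powersetCard,
      Nat.choose_zero_right, Nat.cast_one, one_mul]
  rw [h0]; ring

omit [Fintype P] [DecidableEq P] in
/-- `Σ_{S ⊆ A} bw c |S| = (1+x)^{|A|}·y^c` for `c ≥ 2`. [folklore] -/
theorem sum_bw_two_le {c : ℕ} (hc : 2 ≤ c) (A : Finset P) : ∑ S ∈ A.powerset, bw c S.card = (xK + 1) ^ A.card * yK ^ c := by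
  simp_rw [bw_of_two_le hc, ← sum_mul, sum_powerset_xK]

omit [Fintype P] [DecidableEq P] in
/-- The root block: `Σ_{|S| ≥ 2} x^{|S|} ≤ (1.19)^6 − 1 − 6·0.19 ≤ 7/10`. [folklore] -/
theorem kraft_root (A : Finset P) (hA : A.card ≤ 6) : ∑ S ∈ A.powerset, bw 0 S.card ≤ 7 / 10 := by
  rw [sum_bw_zero]
  obtain ⟨a, ha⟩ : ∃ a, A.card = a := ⟨_, rfl⟩
  rw [ha] at hA ⊢
  interval_cases a <;> (unfold xK; norm_num)

omit [Fintype P] [DecidableEq P] in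
/-- The per-block Kraft inequality whenever `|A| + c ≤ 6`. [folklore] -/
theorem kraft_step (c : ℕ) (A : Finset P) (h : A.card + c ≤ 6) : ∑ S ∈ A.powerset, bw c S.card ≤ 1 := by
  have h1x : (1 : ℝ) ≤ xK + 1 := by unfold xK; norm_num
  rcases Nat.lt_or_ge c 2 with hc | hc
  · interval_cases c
    · exact (kraft_root A (by omega)).trans (by norm_num)
    · rw [sum_bw_one]
      calc ((xK + 1) ^ A.card - 1) * yK ≤ ((xK + 1) ^ 5 - 1) * yK :=
            mul_le_mul_of_nonneg_right (sub_le_sub_right (pow_le_pow_right₀ h1x (by omega)) _) yK_pos.le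
        _ ≤ 1 := by unfold xK yK; norm_num
  · rw [sum_bw_two_le hc]
    calc (xK + 1) ^ A.card * yK ^ c ≤ (xK + 1) ^ 4 * yK ^ 2 :=
          mul_le_mul (pow_le_pow_right₀ h1x (by omega)) (pow_le_pow_of_le_one yK_pos.le yK_le_one hc) (pow_nonneg yK_pos.le _)
            (pow_nonneg (zero_le_one.trans h1x) _)
      _ = 1 := by unfold xK yK; norm_num

omit [Inhabited E] in
/-- At most six plaquettes through a link, split into those already born and the rest. [folklore] -/
theorem card_sdiff_add_card_atLink_le (Y : Finset P) (l : E) : (through 𝓘 l \ Y).card + (atLink 𝓘 Y l).card ≤ 6 := by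
  have hsub : through 𝓘 l \ Y ∪ atLink 𝓘 Y l ⊆ through 𝓘 l := by
    intro p hp
    rcases mem_union.1 hp with hp | hp
    · exact (mem_sdiff.1 hp).1
    · exact mem_filter.2 ⟨mem_univ _, (mem_filter.1 hp).2⟩
  have hdisj : Disjoint (through 𝓘 l \ Y) (atLink 𝓘 Y l) := disjoint_sdiff_self_left.mono_right (filter_subset _ _)
  rw [← card_union_of_disjoint hdisj]
  exact (card_le_card hsub).trans (𝓘.card_through_le l)

/-- **Kraft inequality.** [folklore] -/
theorem kraft : ∀ (k : ℕ) (s : State P E) (𝒳 : Finset (Finset P)), ∑ X ∈ 𝒳, wt 𝓘 Adm k s X ≤ 1 := by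
  have hterm : ∀ (k : ℕ) (s : State P E) (𝒳 : Finset (Finset P)), und 𝓘 Adm s = ∅ → ∑ X ∈ 𝒳, wt 𝓘 Adm k s X ≤ 1 := by
    intro k s 𝒳 h
    simp_rw [wt_terminal 𝓘 Adm h]
    rw [sum_ite_eq]
    split_ifs <;> norm_num
  intro k
  induction k with
  | zero =>
    intro s 𝒳
    by_cases h : und 𝓘 Adm s = ∅
    · exact hterm 0 s 𝒳 h
    · have : ∀ X ∈ 𝒳, wt 𝓘 Adm 0 s X = 0 := fun X _ => by simp [wt, h]
      rw [sum_congr rfl this, sum_const_zero]; exact zero_le_one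
  | succ k ih =>
    intro s 𝒳
    by_cases h : und 𝓘 Adm s = ∅
    · exact hterm (k + 1) s 𝒳 h
    · have hrw0 : ∀ X ∈ 𝒳, wt 𝓘 Adm (k + 1) s X =
          bw (atLink 𝓘 s.Y (sel (und 𝓘 Adm s))).card (atLink 𝓘 (X \ s.Y) (sel (und 𝓘 Adm s))).card *
            wt 𝓘 Adm k ⟨s.Y ∪ atLink 𝓘 (X \ s.Y) (sel (und 𝓘 Adm s)), insert (sel (und 𝓘 Adm s)) s.D⟩ X := fun X _ => wt_succ 𝓘 Adm h
      rw [sum_congr rfl hrw0]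
      generalize sel (und 𝓘 Adm s) = l
      have hmaps : ∀ X ∈ 𝒳, atLink 𝓘 (X \ s.Y) l ∈ (through 𝓘 l \ s.Y).powerset := by
        intro X _
        rw [mem_powerset]
        intro p hp
        obtain ⟨hp1, hp2⟩ := mem_filter.1 hp
        exact mem_sdiff.2 ⟨mem_filter.2 ⟨mem_univ _, hp2⟩, (mem_sdiff.1 hp1).2⟩
      rw [← sum_fiberwise_of_maps_to hmaps]
      have hfib : ∀ S ∈ (through 𝓘 l \ s.Y).powerset,
          ∑ X ∈ 𝒳 with atLink 𝓘 (X \ s.Y) l = S,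
              bw (atLink 𝓘 s.Y l).card (atLink 𝓘 (X \ s.Y) l).card * wt 𝓘 Adm k ⟨s.Y ∪ atLink 𝓘 (X \ s.Y) l, insert l s.D⟩ X
            ≤ bw (atLink 𝓘 s.Y l).card S.card := by
        intro S _
        have hrw : ∀ X ∈ 𝒳.filter (fun X => atLink 𝓘 (X \ s.Y) l = S),
            bw (atLink 𝓘 s.Y l).card (atLink 𝓘 (X \ s.Y) l).card * wt 𝓘 Adm k ⟨s.Y ∪ atLink 𝓘 (X \ s.Y) l, insert l s.D⟩ X =
              bw (atLink 𝓘 s.Y l).card S.card * wt 𝓘 Adm k ⟨s.Y ∪ S, insert l s.D⟩ X := by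
          intro X hX
          rw [(mem_filter.1 hX).2]
        rw [sum_congr rfl hrw, ← mul_sum]
        calc bw (atLink 𝓘 s.Y l).card S.card * ∑ X ∈ 𝒳 with atLink 𝓘 (X \ s.Y) l = S, wt 𝓘 Adm k ⟨s.Y ∪ S, insert l s.D⟩ X
            ≤ bw (atLink 𝓘 s.Y l).card S.card * 1 := mul_le_mul_of_nonneg_left (ih _ _) (bw_nonneg _ _)
          _ = bw (atLink 𝓘 s.Y l).card S.card := mul_one _
      exact (sum_le_sum hfib).trans (kraft_step _ _ (card_sdiff_add_card_atLink_le 𝓘 s.Y l))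

/-- The initial state from the root link `e`. [folklore] -/
def init (e : E) (X : Finset P) : State P E := ⟨atLink 𝓘 X e, {e}⟩

/-- The total weight of the target `X` among `n`-complexes through `e`. [folklore] -/
def W (e : E) (n : ℕ) (X : Finset P) : ℝ := bw 0 (atLink 𝓘 X e).card * wt 𝓘 Adm (4 * n) (init 𝓘 e X) X

/-- **Kraft inequality with the root block**: `≤ 7/10`. [folklore] -/
theorem kraft_root_sum (e : E) (n : ℕ) (𝒳 : Finset (Finset P)) : ∑ X ∈ 𝒳, W 𝓘 Adm e n X ≤ 7 / 10 := by
  have hmaps : ∀ X ∈ 𝒳, atLink 𝓘 X e ∈ (through 𝓘 e).powerset := by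
    intro X _
    rw [mem_powerset]
    intro p hp
    exact mem_filter.2 ⟨mem_univ _, (mem_filter.1 hp).2⟩
  rw [← sum_fiberwise_of_maps_to hmaps]
  have hfib : ∀ S ∈ (through 𝓘 e).powerset, ∑ X ∈ 𝒳 with atLink 𝓘 X e = S, W 𝓘 Adm e n X ≤ bw 0 S.card := by
    intro S _
    have hrw : ∀ X ∈ 𝒳.filter (fun X => atLink 𝓘 X e = S), W 𝓘 Adm e n X = bw 0 S.card * wt 𝓘 Adm (4 * n) ⟨S, {e}⟩ X := by
      intro X hX
      have hS : atLink 𝓘 X e = S := (mem_filter.1 hX).2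
      unfold W init
      rw [hS]
    rw [sum_congr rfl hrw, ← mul_sum]
    calc bw 0 S.card * ∑ X ∈ 𝒳 with atLink 𝓘 X e = S, wt 𝓘 Adm (4 * n) ⟨S, {e}⟩ X
        ≤ bw 0 S.card * 1 := mul_le_mul_of_nonneg_left (kraft 𝓘 Adm _ _ _) (bw_nonneg _ _)
      _ = bw 0 S.card := mul_one _
  exact (sum_le_sum hfib).trans (kraft_root _ (𝓘.card_through_le e))

end Summit.QuantumFields.YangMills.Theorems.Instrument.AbstractPolymerKraft

end
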